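import Summits.ResolutionOfSingularities.ResolutionOfSingularities.Theorems.EquisingularLiftEquisingularLiftNatTwoStepChain
import HarnessLib

/-!
# [OURS] THE DOWNSTAIRS CHAIN AT ARBITRARY FINITE DEPTH: depth-graded descent for an abstract local point-property — item (f3) of lh10's census
# (cruxes `Theses.EquisingularLift.EquisingularLiftNat` / `…NatThree`, stmt-ResolutionOfSingularities-20038 / -20148)

[OURS · leafhand-res-equisingularlift-10 g1, 2026-08-31; cell `pub/decomp-res`] AI-produced, weaker than expert review; NOT a statement of any manuscript;
nothing here proves resolution of singularities in positive characteristic.  DEF-FREE helper; no `sorry`; standard axioms; ZERO named hypotheses.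

✓ `PointChain.chain_of_oneStepPoints` (p829236) and ✓ `PointChain.chain_of_twoStepPoints` (p830907) run the ambient point chain of `IsoHypPoint`
(= `PointResolvable`, hypothesis #7 of the registered isolated residual stub) through finitely many singular points of blow-up depth `1`, resp. `≤ 2`.
Here the depth is ARBITRARY and the point-property is ABSTRACT: a family `D : ℕ → Π Γ, Γ → Prop` («`y` is a `D`-point of level `d` on `Γ`») subject to

* UNFOLDING `hDstep` — a level-`d` point `y` (closed) of `Γ` and a blow-up `τ : Z → Γ` of `Γ` at the reduced point `y`: `Z` is regular over `y` except at
  finitely many CLOSED points of levels `< d` (so level `0` = ONE-STEP, level `1` ⊇ TWO-STEP, `A₅ / D₅ / E₆ …` sit at higher levels);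
* LOCALITY `hDloc` — for `ρ : Γ₂ → Γ` an isomorphism over an open `U ∋ y` and closed points `y₂ ↦ y`: `D d Γ y ↔ D d Γ₂ y₂`.

* ★★★ `PointChain.chain_of_finiteDepthPoints` — **THE DOWNSTAIRS INDUCTION AT DEPTH `M`**: singular points `S₁` (levels `< M`) and `S₂` (level `M`); strong
  induction on `M`, inside induction on `|S₂|`; `|S₂| = 0`: re-split `S₁` at level `M - 1` (resp. everything regular when `M = 0`); step: blow up `x ∈ S₂` —
  the new reduced strict transform is a blow-up of `Γ` at `x` (✓ `exists_isBlowup_reducedStrictTransform_point`), the old points keep their levels by LOCALITY,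
  the finitely many new closed singular points over `x` have levels `< M` by UNFOLDING;
* (next file) `isoHypPoint_of_finiteDepthPoints` — the `IsoHypPoint` wrapper.

Honest label: closes no registered stub; instantiating `D` (the intrinsic blow-up tower, `Aₙ / Dₙ / Eₙ` chart data) is separate work.

References: [StacksProject, Tags 080E, 02OS]; [GortzWedhorn2020, Prop. 13.91]; [Hartshorne1977, II Ex. 7.12, V 3.9] — through the cited tree files.
-/

set_option linter.dupNamespace false -- mandated namespace `Summit.<Summit>.<Problem>` of this single-conjunct summit

noncomputable section

open CategoryTheory CategoryTheory.Limits AlgebraicGeometry TopologicalSpace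
open Literature.AlgebraicGeometry.Resolution Literature.AlgebraicGeometry.Motives
open AlgebraicGeometry.Scheme.IdealSheafData

namespace Summit.ResolutionOfSingularities.ResolutionOfSingularities.Cruxes.EquisingularLiftNat.Sections

namespace PointChain

/-- ★★★ **THE DOWNSTAIRS INDUCTION AT ARBITRARY FINITE DEPTH.**  `D` a depth-graded point-property with UNFOLDING (`hDstep`) and LOCALITY (`hDloc`).  A stage
`(F, ρ_F, T)` of the ambient point chain (`F` locally Noetherian, `T` closed irreducible) whose reduced strict transform `Γ = V(T)_red` is regular exactly off
the finite set `S₁ ∪ S₂` of closed points, the points of `S₁` of levels `< M` and the points of `S₂` of level `M`, with a point `ξ ∈ T` off `S₁ ∪ S₂`, reaches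
a stage with REGULAR reduced strict transform, uniformly in the chain predicate `Q`.  Strong induction on `M`, inside induction on `|S₂|`; step: blow up `x ∈ S₂`.
[OURS] [cite: StacksProject, Tag 080E] [cite: GortzWedhorn2020, Prop. 13.91] -/
theorem chain_of_finiteDepthPoints {P : Scheme.{0}} (D : ℕ → ∀ Γ : Scheme.{0}, Γ → Prop)
    (hDstep : ∀ (d : ℕ) (Γ : Scheme.{0}) (y : Γ), D d Γ y → ∀ (hy : IsClosed ({y} : Set Γ)) (Z : Scheme.{0}) (τ : Z ⟶ Γ),
      IsBlowup τ (vanishingIdeal ⟨{y}, hy⟩) →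
      ∃ S' : Finset Z, (∀ z : Z, τ z = y → z ∉ S' → IsRegularLocalRing (Z.presheaf.stalk z)) ∧
        ∀ z ∈ S', τ z = y ∧ IsClosed ({z} : Set Z) ∧ ∃ d' < d, D d' Z z)
    (hDloc : ∀ (d : ℕ) (Γ Γ₂ : Scheme.{0}) (ρ : Γ₂ ⟶ Γ) (U : Γ.Opens), IsIso (ρ ∣_ U) → ∀ y : Γ, y ∈ U → IsClosed ({y} : Set Γ) →
      ∀ y₂ : Γ₂, ρ y₂ = y → IsClosed ({y₂} : Set Γ₂) → (D d Γ y ↔ D d Γ₂ y₂)) :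
    ∀ (M N : ℕ) (F : Scheme.{0}) [IsLocallyNoetherian F] (ρF : F ⟶ P) (T : Set F) (_ : IsClosed T) (_ : IsIrreducible T)
      (C : Closeds F) (_ : (⟨closure T, isClosed_closure⟩ : Closeds F) = C)
      (S₁ S₂ : Finset ↥(vanishingIdeal C).subscheme) (_ : S₂.card = N)
      (ξ : F) (_ : ξ ∈ (C : Set F)) (_ : ∀ x, x ∈ S₁ ∨ x ∈ S₂ → ((vanishingIdeal C).subschemeι x : F) ≠ ξ)
      (_ : ∀ x : ↥(vanishingIdeal C).subscheme, x ∉ S₁ → x ∉ S₂ → IsRegularLocalRing ((vanishingIdeal C).subscheme.presheaf.stalk x))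
      (_ : ∀ x, x ∈ S₁ ∨ x ∈ S₂ → IsClosed ({((vanishingIdeal C).subschemeι x : F)} : Set F))
      (_ : ∀ x, x ∈ S₁ ∨ x ∈ S₂ → ¬ IsRegularLocalRing ((vanishingIdeal C).subscheme.presheaf.stalk x))
      (_ : ∀ x ∈ S₁, ∃ d < M, D d (vanishingIdeal C).subscheme x)
      (_ : ∀ x ∈ S₂, D M (vanishingIdeal C).subscheme x),
      ∃ (F' : Scheme.{0}) (ρ' : F' ⟶ P) (T' : Set F'),
        (∀ Q : (∀ F₁ : Scheme.{0}, (F₁ ⟶ P) → Set F₁ → Prop),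
          (∀ (F₁ F₂ : Scheme.{0}) (ρ : F₁ ⟶ P) (T₁ : Set F₁)
            (x : ↥(vanishingIdeal (⟨closure T₁, isClosed_closure⟩ : Closeds F₁)).subscheme) (υ : F₂ ⟶ F₁)
            (hx : IsClosed ({((vanishingIdeal (⟨closure T₁, isClosed_closure⟩ : Closeds F₁)).subschemeι x : F₁)} : Set F₁)),
            Q F₁ ρ T₁ → ¬ IsRegularLocalRing ((vanishingIdeal (⟨closure T₁, isClosed_closure⟩ : Closeds F₁)).subscheme.presheaf.stalk x) →
            IsBlowup υ (vanishingIdeal (⟨{((vanishingIdeal (⟨closure T₁, isClosed_closure⟩ : Closeds F₁)).subschemeι x : F₁)}, hx⟩ :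
              Closeds F₁)) →
            Q F₂ (υ ≫ ρ) (closure (υ ⁻¹' (T₁ \ {((vanishingIdeal (⟨closure T₁, isClosed_closure⟩ : Closeds F₁)).subschemeι x : F₁)})))) →
          Q F ρF T → Q F' ρ' T') ∧
        Scheme.IsRegular (vanishingIdeal (⟨closure T', isClosed_closure⟩ : Closeds F')).subscheme := by
  intro M
  induction M using Nat.strong_induction_on with
  | _ M ihM =>
  intro N
  induction N with
  | zero =>
    intro F _ ρF T hT hTirr C hTC S₁ S₂ hS₂ ξ hξC hξS hreg hcl hsing hlo hhi
    have hS₂e : S₂ = ∅ := Finset.card_eq_zero.mp hS₂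
    subst hS₂e
    cases M with
    | zero =>
      -- no levels `< 0`: `S₁ = ∅` as well, the strict transform is already regular
      subst hTC
      refine ⟨F, ρF, T, fun Q _ hQ => hQ, fun x => hreg x ?_ (Finset.notMem_empty x)⟩
      intro hx
      obtain ⟨d, hd, -⟩ := hlo x hx
      exact Nat.not_lt_zero d hd
    | succ M' =>
      -- re-split `S₁` at level `M'` and descend
      classical
      let S₁' : Finset ↥(vanishingIdeal C).subscheme := S₁.filter fun x => ∃ d < M', D d (vanishingIdeal C).subscheme x
      let S₂' : Finset ↥(vanishingIdeal C).subscheme := S₁.filter fun x => ¬ ∃ d < M', D d (vanishingIdeal C).subscheme x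
      have hmem₁ : ∀ x, x ∈ S₁' ↔ x ∈ S₁ ∧ ∃ d < M', D d (vanishingIdeal C).subscheme x := fun x => Finset.mem_filter
      have hmem₂ : ∀ x, x ∈ S₂' ↔ x ∈ S₁ ∧ ¬ ∃ d < M', D d (vanishingIdeal C).subscheme x := fun x => Finset.mem_filter
      have hback : ∀ x, x ∈ S₁' ∨ x ∈ S₂' → x ∈ S₁ ∨ x ∈ (∅ : Finset ↥(vanishingIdeal C).subscheme) := by
        rintro x (h | h)
        · exact Or.inl ((hmem₁ x).mp h).1
        · exact Or.inl ((hmem₂ x).mp h).1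
      have hforth : ∀ x, x ∉ S₁' → x ∉ S₂' → x ∉ S₁ := by
        intro x h₁ h₂ hx
        by_cases h : ∃ d < M', D d (vanishingIdeal C).subscheme x
        · exact h₁ ((hmem₁ x).mpr ⟨hx, h⟩)
        · exact h₂ ((hmem₂ x).mpr ⟨hx, h⟩)
      refine ihM M' (Nat.lt_succ_self M') S₂'.card F ρF T hT hTirr C hTC S₁' S₂' rfl ξ hξC (fun x hx => hξS x (hback x hx))
        (fun x h₁ h₂ => hreg x (hforth x h₁ h₂) (Finset.notMem_empty x)) (fun x hx => hcl x (hback x hx))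
        (fun x hx => hsing x (hback x hx)) (fun x hx => ((hmem₁ x).mp hx).2) ?_
      intro x hx
      obtain ⟨hxS₁, hnot⟩ := (hmem₂ x).mp hx
      obtain ⟨d, hd, hD⟩ := hlo x hxS₁
      have hdM' : d = M' := by
        by_contra hne
        exact hnot ⟨d, by omega, hD⟩
      rw [← hdM']
      exact hD
  | succ N ih =>
    intro F _ ρF T hT hTirr C hTC S₁ S₂ hS ξ hξC hξS hreg hcl hsing hlo hhi
    subst hTC
    classical
    -- notation
    have hclT : closure T = T := hT.closure_eq
    -- pick a level-`M` point to blow up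
    obtain ⟨x, hxS₂⟩ : S₂.Nonempty := Finset.card_pos.mp (by omega)
    have hxS : x ∈ S₁ ∨ x ∈ S₂ := Or.inr hxS₂
    have hx := hcl x hxS
    have hxsing := hsing x hxS
    have hne : ¬ (closure T ⊆ {((vanishingIdeal (⟨closure T, isClosed_closure⟩ : Closeds F)).subschemeι x : F)}) :=
      fun h => hξS x hxS (Set.mem_singleton_iff.mp (h hξC)).symm
    -- the ambient blow-up at `ι x`
    obtain ⟨𝔫, h𝔫⟩ : ∃ 𝔫 : F.IdealSheafData,
        𝔫 = vanishingIdeal (⟨{((vanishingIdeal (⟨closure T, isClosed_closure⟩ : Closeds F)).subschemeι x : F)}, hx⟩ : Closeds F) := ⟨_, rfl⟩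
    have hυ : IsBlowup (blowup.π 𝔫) 𝔫 := blowup.isBlowup 𝔫
    haveI : IsProper (blowup.π 𝔫) := hυ.isProper
    haveI : IsLocallyNoetherian (blowup 𝔫) := LocallyOfFiniteType.isLocallyNoetherian (blowup.π 𝔫)
    have hυ' : IsBlowup (blowup.π 𝔫)
        (vanishingIdeal (⟨{((vanishingIdeal (⟨closure T, isClosed_closure⟩ : Closeds F)).subschemeι x : F)}, hx⟩ : Closeds F)) := by
      rw [← h𝔫]; exact hυ
    -- the reduced strict transform is a blow-up of `Γ` at `x`
    obtain ⟨hxcl, ρ, hρι, -, hρbl⟩ := exists_isBlowup_reducedStrictTransform_point F (blowup 𝔫) (closure T) isClosed_closure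
      hTirr.closure x hx hne (blowup.π 𝔫) hυ'
    generalize hC₂ : (⟨closure ((blowup.π 𝔫) ⁻¹' (closure T \ ((vanishingIdeal (⟨{((vanishingIdeal (⟨closure T, isClosed_closure⟩ :
        Closeds F)).subschemeι x : F)}, hx⟩ : Closeds F)).support : Set F))), isClosed_closure⟩ : Closeds (blowup 𝔫)) = C₂ at ρ hρι hρbl
    -- shorthand facts
    have hsuppx : ((vanishingIdeal (⟨{((vanishingIdeal (⟨closure T, isClosed_closure⟩ : Closeds F)).subschemeι x : F)}, hx⟩ :
        Closeds F)).support : Set F) = {((vanishingIdeal (⟨closure T, isClosed_closure⟩ : Closeds F)).subschemeι x : F)} :=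
      Scheme.IdealSheafData.coe_support_vanishingIdeal _
    have hιinj : Function.Injective (vanishingIdeal (⟨closure T, isClosed_closure⟩ : Closeds F)).subschemeι :=
      (vanishingIdeal (⟨closure T, isClosed_closure⟩ : Closeds F)).subschemeι.isClosedEmbedding.injective
    have hι₂inj : Function.Injective (vanishingIdeal C₂).subschemeι := (vanishingIdeal C₂).subschemeι.isClosedEmbedding.injective
    have hρι_apply : ∀ z : ↥(vanishingIdeal C₂).subscheme,
        (vanishingIdeal (⟨closure T, isClosed_closure⟩ : Closeds F)).subschemeι (ρ z) = (blowup.π 𝔫) ((vanishingIdeal C₂).subschemeι z) :=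
      fun z => by rw [← Scheme.Hom.comp_apply, hρι, Scheme.Hom.comp_apply]
    have hC₂set : (C₂ : Set (blowup 𝔫)) = closure ((blowup.π 𝔫) ⁻¹' (T \ {((vanishingIdeal (⟨closure T, isClosed_closure⟩ :
        Closeds F)).subschemeι x : F)})) := by
      rw [← hC₂]
      change closure ((blowup.π 𝔫) ⁻¹' (closure T \ _)) = closure _
      rw [hsuppx]
      have hmemclT : ∀ w, w ∈ closure T ↔ w ∈ T := fun w => by rw [hclT]
      have hAB : closure T \ {((vanishingIdeal (⟨closure T, isClosed_closure⟩ : Closeds F)).subschemeι x : F)} =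
          T \ {((vanishingIdeal (⟨closure T, isClosed_closure⟩ : Closeds F)).subschemeι x : F)} := by
        rw [Set.ext_iff]; intro w; simp only [Set.mem_sdiff, hmemclT]
      rw [hAB]
    -- integrality of `Γ` and of the blown-up `Γ₂`
    haveI hΓint : IsIntegral (vanishingIdeal (⟨closure T, isClosed_closure⟩ : Closeds F)).subscheme :=
      isIntegral_subscheme_vanishingIdeal _ hTirr.closure
    obtain ⟨ξ', hξ'⟩ : ∃ ξ' : ↥(vanishingIdeal (⟨closure T, isClosed_closure⟩ : Closeds F)).subscheme,
        (vanishingIdeal (⟨closure T, isClosed_closure⟩ : Closeds F)).subschemeι ξ' = ξ := by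
      have h : ξ ∈ Set.range (vanishingIdeal (⟨closure T, isClosed_closure⟩ : Closeds F)).subschemeι := by
        rw [Scheme.IdealSheafData.range_subschemeι, Scheme.IdealSheafData.coe_support_vanishingIdeal]; exact hξC
      exact h
    have hξ'x : ξ' ≠ x := fun h => hξS x hxS (by rw [← hξ', h])
    have h𝔪ne : vanishingIdeal (⟨{x}, hxcl⟩ : Closeds ↥(vanishingIdeal (⟨closure T, isClosed_closure⟩ : Closeds F)).subscheme) ≠ ⊥ := by
      intro h
      have hs := congrArg (fun I : ((vanishingIdeal (⟨closure T, isClosed_closure⟩ : Closeds F)).subscheme).IdealSheafData =>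
        (I.support : Set ↥(vanishingIdeal (⟨closure T, isClosed_closure⟩ : Closeds F)).subscheme)) h
      simp only [Scheme.IdealSheafData.coe_support_vanishingIdeal, Scheme.IdealSheafData.support_bot] at hs
      have hmem : ξ' ∈ (((⊤ : Closeds ↥(vanishingIdeal (⟨closure T, isClosed_closure⟩ : Closeds F)).subscheme)) :
          Set ↥(vanishingIdeal (⟨closure T, isClosed_closure⟩ : Closeds F)).subscheme) := trivial
      rw [← hs] at hmem
      exact hξ'x (Set.mem_singleton_iff.mp hmem)
    haveI hΓ₂int : IsIntegral (vanishingIdeal C₂).subscheme := hρbl.isIntegral h𝔪ne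
    -- the opens off `x` (in `Γ`) and off `ι x` (in `F`), over which `ρ` and the ambient blow-up are isomorphisms
    obtain ⟨UΓ, hUΓ⟩ : ∃ UΓ : ((vanishingIdeal (⟨closure T, isClosed_closure⟩ : Closeds F)).subscheme).Opens,
        (UΓ : Set _) = {x}ᶜ := ⟨⟨{x}ᶜ, hxcl.isOpen_compl⟩, rfl⟩
    have hmemUΓ : ∀ y, y ∈ UΓ ↔ y ≠ x := fun y => by change y ∈ (UΓ : Set _) ↔ _; rw [hUΓ]; rfl
    haveI hρU : IsIso (ρ ∣_ UΓ) := hρbl.isIso_morphismRestrict (by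
      rw [hUΓ, Scheme.IdealSheafData.coe_support_vanishingIdeal]; exact disjoint_compl_left)
    obtain ⟨UF, hUF⟩ : ∃ UF : F.Opens,
        (UF : Set F) = {((vanishingIdeal (⟨closure T, isClosed_closure⟩ : Closeds F)).subschemeι x : F)}ᶜ := ⟨⟨_, hx.isOpen_compl⟩, rfl⟩
    have hmemUF : ∀ w, w ∈ UF ↔ w ≠ ((vanishingIdeal (⟨closure T, isClosed_closure⟩ : Closeds F)).subschemeι x : F) :=
      fun w => by change w ∈ (UF : Set F) ↔ _; rw [hUF]; rfl
    haveI : IsIso ((blowup.π 𝔫) ∣_ UF) := hυ'.isIso_morphismRestrict (by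
      rw [hUF, Scheme.IdealSheafData.coe_support_vanishingIdeal]; exact disjoint_compl_left)
    -- the preimages of the remaining singular points
    have hpre : ∀ y : ↥(vanishingIdeal (⟨closure T, isClosed_closure⟩ : Closeds F)).subscheme, y ≠ x →
        ∃ z : ↥(vanishingIdeal C₂).subscheme, ρ z = y := fun y hy => exists_preimage_of_isIso_morphismRestrict ρ UΓ ((hmemUΓ y).mpr hy)
    choose σ hσ using hpre
    have huniq : ∀ (z : ↥(vanishingIdeal C₂).subscheme) (hz : ρ z ≠ x), z = σ (ρ z) hz := fun z hz =>
      eq_of_isIso_morphismRestrict ρ UΓ ((hmemUΓ _).mpr hz) (hσ _ hz).symm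
    -- transports of the old singular points
    let emb₁ : {y // y ∈ S₁.erase x} → ↥(vanishingIdeal C₂).subscheme := fun y => σ y.1 (Finset.ne_of_mem_erase y.2)
    let emb₂ : {y // y ∈ S₂.erase x} → ↥(vanishingIdeal C₂).subscheme := fun y => σ y.1 (Finset.ne_of_mem_erase y.2)
    have hemb₁ρ : ∀ y : {y // y ∈ S₁.erase x}, ρ (emb₁ y) = y.1 := fun y => hσ _ _
    have hemb₂ρ : ∀ y : {y // y ∈ S₂.erase x}, ρ (emb₂ y) = y.1 := fun y => hσ _ _
    have hemb₂inj : Function.Injective emb₂ := fun y₁ y₂ h => Subtype.ext (by rw [← hemb₂ρ y₁, ← hemb₂ρ y₂, h])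
    let L₁ : Finset ↥(vanishingIdeal C₂).subscheme := (S₁.erase x).attach.image emb₁
    let L₂ : Finset ↥(vanishingIdeal C₂).subscheme := (S₂.erase x).attach.image emb₂
    have hmemL₁ : ∀ z, z ∈ L₁ → ∃ y : {y // y ∈ S₁.erase x}, emb₁ y = z := fun z hz => by
      obtain ⟨y, -, hy⟩ := Finset.mem_image.mp hz; exact ⟨y, hy⟩
    have hmemL₂ : ∀ z, z ∈ L₂ → ∃ y : {y // y ∈ S₂.erase x}, emb₂ y = z := fun z hz => by
      obtain ⟨y, -, hy⟩ := Finset.mem_image.mp hz; exact ⟨y, hy⟩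
    -- the new points over `x` (levels `< M` by UNFOLDING), restricted to the non-regular ones
    obtain ⟨Sx, hSxreg, hSx⟩ := hDstep M _ x (hhi x hxS₂) hxcl _ ρ hρbl
    let Lx : Finset ↥(vanishingIdeal C₂).subscheme := Sx.filter fun z => ¬ IsRegularLocalRing (((vanishingIdeal C₂).subscheme).presheaf.stalk z)
    have hmemLx : ∀ z, z ∈ Lx ↔ z ∈ Sx ∧ ¬ IsRegularLocalRing (((vanishingIdeal C₂).subscheme).presheaf.stalk z) := fun z => Finset.mem_filter
    -- the new singular sets
    let T₁ : Finset ↥(vanishingIdeal C₂).subscheme := L₁ ∪ Lx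
    -- membership bookkeeping: a point off `T₁ ∪ L₂` and off the fibre of `x` lies over a point off `S₁ ∪ S₂`
    have hnot₁ : ∀ z, z ∉ T₁ → ρ z ≠ x → ρ z ∉ S₁ := by
      intro z hz hzx hρz
      exact hz (Finset.mem_union_left _
        (Finset.mem_image.mpr ⟨⟨ρ z, Finset.mem_erase.mpr ⟨hzx, hρz⟩⟩, Finset.mem_attach _ _, (huniq z hzx).symm⟩))
    have hnot₂ : ∀ z, z ∉ L₂ → ρ z ≠ x → ρ z ∉ S₂ := by
      intro z hz hzx hρz
      exact hz (Finset.mem_image.mpr ⟨⟨ρ z, Finset.mem_erase.mpr ⟨hzx, hρz⟩⟩, Finset.mem_attach _ _, (huniq z hzx).symm⟩)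
    -- closed points of `Γ₂` over closed points of `Γ` off `x`
    have hcl₂ : ∀ z : ↥(vanishingIdeal C₂).subscheme, ρ z ≠ x →
        IsClosed ({((vanishingIdeal (⟨closure T, isClosed_closure⟩ : Closeds F)).subschemeι (ρ z) : F)} : Set F) →
        IsClosed ({((vanishingIdeal C₂).subschemeι z : blowup 𝔫)} : Set (blowup 𝔫)) := by
      intro z hzx hzcl
      have hzUF : (blowup.π 𝔫) ((vanishingIdeal C₂).subschemeι z) ∈ UF := by
        rw [hmemUF, ← hρι_apply]
        exact fun h => hzx (hιinj h)
      have e : ({((vanishingIdeal C₂).subschemeι z : blowup 𝔫)} : Set (blowup 𝔫)) =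
          (blowup.π 𝔫) ⁻¹' {((vanishingIdeal (⟨closure T, isClosed_closure⟩ : Closeds F)).subschemeι (ρ z) : F)} := by
        ext w
        simp only [Set.mem_singleton_iff, Set.mem_preimage]
        exact ⟨fun h => by rw [h, ← hρι_apply], fun h => (eq_of_isIso_morphismRestrict (blowup.π 𝔫) UF hzUF (by rw [← hρι_apply, ← h])).symm⟩
      rw [e]; exact hzcl.preimage (blowup.π 𝔫).continuous
    -- transport of regularity along `ρ` off `x`
    have hρreg : ∀ z : ↥(vanishingIdeal C₂).subscheme, ρ z ≠ x →
        (IsRegularLocalRing (((vanishingIdeal C₂).subscheme).presheaf.stalk z) ↔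
          IsRegularLocalRing (((vanishingIdeal (⟨closure T, isClosed_closure⟩ : Closeds F)).subscheme).presheaf.stalk (ρ z))) := by
      intro z hzx
      haveI := IsBlowup.isIso_stalkMap_of_not_mem_support hρbl (x' := z) (fun h => hzx (by
        have h' : ρ z ∈ ((vanishingIdeal (⟨{x}, hxcl⟩ : Closeds _)).support : Set _) := h
        rwa [Scheme.IdealSheafData.coe_support_vanishingIdeal] at h'))
      constructor
      · intro h
        haveI := h
        exact IsRegularLocalRing.of_ringEquiv (R := ((vanishingIdeal C₂).subscheme).presheaf.stalk z)
          (asIso (ρ.stalkMap z)).commRingCatIsoToRingEquiv.symm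
      · intro h
        haveI := h
        exact IsRegularLocalRing.of_ringEquiv
          (R := ((vanishingIdeal (⟨closure T, isClosed_closure⟩ : Closeds F)).subscheme).presheaf.stalk (ρ z))
          (asIso (ρ.stalkMap z)).commRingCatIsoToRingEquiv
    -- the point `ξ₂` over `ξ`
    have hξUF : ξ ∈ UF := (hmemUF ξ).mpr (fun h => hξS x hxS h.symm)
    obtain ⟨ξ₂, hξ₂⟩ := exists_preimage_of_isIso_morphismRestrict (blowup.π 𝔫) UF hξUF
    have hξT : ξ ∈ T := by rw [← hclT]; exact hξC
    have hξ₂C : ξ₂ ∈ (C₂ : Set (blowup 𝔫)) := by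
      rw [hC₂set]; apply subset_closure
      exact ⟨show (blowup.π 𝔫) ξ₂ ∈ T by rw [hξ₂]; exact hξT, show (blowup.π 𝔫) ξ₂ ∉ _ by rw [hξ₂]; exact (hmemUF ξ).mp hξUF⟩
    have hξ₂S : ∀ z, z ∈ T₁ ∨ z ∈ L₂ → ((vanishingIdeal C₂).subschemeι z : blowup 𝔫) ≠ ξ₂ := by
      intro z hz h
      have hzξ : (vanishingIdeal (⟨closure T, isClosed_closure⟩ : Closeds F)).subschemeι (ρ z) = ξ := by rw [hρι_apply, h, hξ₂]
      rcases hz with hz1 | hz2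
      · rcases Finset.mem_union.mp hz1 with hzL | hzLx
        · obtain ⟨y, rfl⟩ := hmemL₁ z hzL
          exact hξS y.1 (Or.inl (Finset.mem_of_mem_erase y.2)) (by rw [← hemb₁ρ y]; exact hzξ)
        · have hzx : ρ z = x := (hSx z ((hmemLx z).mp hzLx).1).1
          exact hξS x hxS (by rw [← hzx]; exact hzξ)
      · obtain ⟨y, rfl⟩ := hmemL₂ z hz2
        exact hξS y.1 (Or.inr (Finset.mem_of_mem_erase y.2)) (by rw [← hemb₂ρ y]; exact hzξ)
    -- the next strict transform is closed irreducible, with reduced closure `Γ₂`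
    have hT₂irr : IsIrreducible (closure ((blowup.π 𝔫) ⁻¹' (T \ {((vanishingIdeal (⟨closure T, isClosed_closure⟩ :
        Closeds F)).subschemeι x : F)}))) := by
      have hr : Set.range (vanishingIdeal C₂).subschemeι = closure ((blowup.π 𝔫) ⁻¹' (T \
          {((vanishingIdeal (⟨closure T, isClosed_closure⟩ : Closeds F)).subschemeι x : F)})) := by
        rw [Scheme.IdealSheafData.range_subschemeι, Scheme.IdealSheafData.coe_support_vanishingIdeal, hC₂set]
      rw [← hr, ← Set.image_univ]
      exact (IrreducibleSpace.isIrreducible_univ _).image _ (Scheme.Hom.continuous _).continuousOn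
    have hTC₂ : (⟨closure (closure ((blowup.π 𝔫) ⁻¹' (T \ {((vanishingIdeal (⟨closure T, isClosed_closure⟩ :
        Closeds F)).subschemeι x : F)}))), isClosed_closure⟩ : Closeds (blowup 𝔫)) = C₂ := Closeds.ext (by
      change closure (closure _) = (C₂ : Set (blowup 𝔫))
      rw [closure_closure, hC₂set])
    -- the hypotheses of the induction at the next stage
    have hcard : L₂.card = N := by
      rw [Finset.card_image_of_injective _ hemb₂inj, Finset.card_attach, Finset.card_erase_of_mem hxS₂, hS]
      rfl
    have hreg₂ : ∀ z : ↥(vanishingIdeal C₂).subscheme, z ∉ T₁ → z ∉ L₂ → IsRegularLocalRing (((vanishingIdeal C₂).subscheme).presheaf.stalk z) := by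
      intro z hz₁ hz₂
      by_cases hzx : ρ z = x
      · by_cases hzSx : z ∈ Sx
        · by_contra hnreg
          exact hz₁ (Finset.mem_union_right _ ((hmemLx z).mpr ⟨hzSx, hnreg⟩))
        · exact hSxreg z hzx hzSx
      · exact (hρreg z hzx).mpr (hreg (ρ z) (hnot₁ z hz₁ hzx) (hnot₂ z hz₂ hzx))
    have hcl₂' : ∀ z, z ∈ T₁ ∨ z ∈ L₂ → IsClosed ({((vanishingIdeal C₂).subschemeι z : blowup 𝔫)} : Set (blowup 𝔫)) := by
      intro z hz
      rcases hz with hz1 | hz2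
      · rcases Finset.mem_union.mp hz1 with hzL | hzLx
        · obtain ⟨y, rfl⟩ := hmemL₁ z hzL
          have hyx : ρ (emb₁ y) ≠ x := by rw [hemb₁ρ]; exact Finset.ne_of_mem_erase y.2
          refine hcl₂ (emb₁ y) hyx ?_
          rw [hemb₁ρ]
          exact hcl y.1 (Or.inl (Finset.mem_of_mem_erase y.2))
        · obtain ⟨-, hzcl, -⟩ := hSx z ((hmemLx z).mp hzLx).1
          have h := (vanishingIdeal C₂).subschemeι.isClosedEmbedding.isClosedMap _ hzcl
          rwa [Set.image_singleton] at h
      · obtain ⟨y, rfl⟩ := hmemL₂ z hz2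
        have hyx : ρ (emb₂ y) ≠ x := by rw [hemb₂ρ]; exact Finset.ne_of_mem_erase y.2
        refine hcl₂ (emb₂ y) hyx ?_
        rw [hemb₂ρ]
        exact hcl y.1 (Or.inr (Finset.mem_of_mem_erase y.2))
    have hsing₂ : ∀ z, z ∈ T₁ ∨ z ∈ L₂ → ¬ IsRegularLocalRing (((vanishingIdeal C₂).subscheme).presheaf.stalk z) := by
      intro z hz hzreg
      rcases hz with hz1 | hz2
      · rcases Finset.mem_union.mp hz1 with hzL | hzLx
        · obtain ⟨y, rfl⟩ := hmemL₁ z hzL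
          have hyx : ρ (emb₁ y) ≠ x := by rw [hemb₁ρ]; exact Finset.ne_of_mem_erase y.2
          apply hsing y.1 (Or.inl (Finset.mem_of_mem_erase y.2))
          rw [← hemb₁ρ y]
          exact (hρreg _ hyx).mp hzreg
        · exact ((hmemLx z).mp hzLx).2 hzreg
      · obtain ⟨y, rfl⟩ := hmemL₂ z hz2
        have hyx : ρ (emb₂ y) ≠ x := by rw [hemb₂ρ]; exact Finset.ne_of_mem_erase y.2
        apply hsing y.1 (Or.inr (Finset.mem_of_mem_erase y.2))
        rw [← hemb₂ρ y]
        exact (hρreg _ hyx).mp hzreg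
    -- LOCALITY: the transport `σ y` of an old singular point `y ≠ x` has the level of `y`
    have htransp : ∀ (d : ℕ) (y : ↥(vanishingIdeal (⟨closure T, isClosed_closure⟩ : Closeds F)).subscheme) (hyS : y ∈ S₁ ∨ y ∈ S₂)
        (hyx : y ≠ x), D d _ y → D d _ (σ y hyx) := by
      intro d y hyS hyx hD
      have hycl : IsClosed ({y} : Set ↥(vanishingIdeal (⟨closure T, isClosed_closure⟩ : Closeds F)).subscheme) :=
        isClosed_singleton_of_injective _ hιinj (hcl y hyS)
      have hσcl : IsClosed ({σ y hyx} : Set ↥(vanishingIdeal C₂).subscheme) := by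
        refine isClosed_singleton_of_injective _ hι₂inj (hcl₂ (σ y hyx) (by rw [hσ]; exact hyx) ?_)
        rw [hσ]; exact hcl y hyS
      exact (hDloc d _ _ ρ UΓ hρU y ((hmemUΓ y).mpr hyx) hycl (σ y hyx) (hσ y hyx) hσcl).mp hD
    have hlo₂ : ∀ z ∈ T₁, ∃ d < M, D d (vanishingIdeal C₂).subscheme z := by
      intro z hz
      rcases Finset.mem_union.mp hz with hzL | hzLx
      · obtain ⟨y, rfl⟩ := hmemL₁ z hzL
        have hyS : y.1 ∈ S₁ := Finset.mem_of_mem_erase y.2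
        obtain ⟨d, hd, hD⟩ := hlo y.1 hyS
        exact ⟨d, hd, htransp d y.1 (Or.inl hyS) (Finset.ne_of_mem_erase y.2) hD⟩
      · exact (hSx z ((hmemLx z).mp hzLx).1).2.2
    have hhi₂ : ∀ z ∈ L₂, D M (vanishingIdeal C₂).subscheme z := by
      intro z hz
      obtain ⟨y, rfl⟩ := hmemL₂ z hz
      have hyS : y.1 ∈ S₂ := Finset.mem_of_mem_erase y.2
      exact htransp M y.1 (Or.inr hyS) (Finset.ne_of_mem_erase y.2) (hhi y.1 hyS)
    -- INDUCTION
    obtain ⟨F', ρ', T', hF', hreg'⟩ := ih (blowup 𝔫) (blowup.π 𝔫 ≫ ρF) _ isClosed_closure hT₂irr C₂ hTC₂ T₁ L₂ hcard ξ₂ hξ₂C hξ₂S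
      hreg₂ hcl₂' hsing₂ hlo₂ hhi₂
    exact ⟨F', ρ', T', fun Q hstep hQ => hF' Q hstep (hstep F (blowup 𝔫) ρF T x (blowup.π 𝔫) hx hQ hxsing hυ'), hreg'⟩

end PointChain

end Summit.ResolutionOfSingularities.ResolutionOfSingularities.Cruxes.EquisingularLiftNat.Sections

end
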